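import Summits.CriticalPhenomena.PercolationContinuityZ3.Theorems.PercNearOneGluingNoHeavyQuantFarSunGameLamLink
import Summits.CriticalPhenomena.PercolationContinuityZ3.Theorems.PercNearOneGluingNoHeavyQuantFarSunGameFast
import Summits.CriticalPhenomena.PercolationContinuityZ3.Theorems.PercNearOneGluingNoHeavyQuantFarSunGameThr
import Summits.CriticalPhenomena.PercolationContinuityZ3.Theorems.PercNearOneGluingNoHeavyQuantFarSunLayerTwoMid
import Summits.CriticalPhenomena.PercolationContinuityZ3.Theorems.PercNearOneGluingNoHeavyQuantFarSunLayerTwoAllK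
import HarnessLib

/-!
# FAR beyond trees: `R`-SLACK (threshold) CERTIFICATES ⇒ `G_avg ≥ 1` on a cell box

builds on p205010 (kernel theorem, internal audit signed; external expert review pending)

Support file (`--supports stmt-CriticalPhenomena-4575`), seat `prim-cert-1` (gen 39); memo `prim-cert-1/FROM-prim-cert-1-g39-VERTEX-GAME.md` §7 (revised).

The λ-refined game (…GameLam) certifies, for every word `v` of budget `B` in the list, `E_v[flankPay] − λ·(1 − F(v)) ≥ t_B/(q^K·Lpay)`
(`HairyCycle.sum_hairW_flankPay_sub_ge_of_gameCertT`, …GameLamLink).  With ONE multiplier `λ` for the whole cell and thresholds `t_B ≥ −λ·C·q^K·Lpay`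
at every vertex word of the box of a configuration `h`, where `C ≤ 1 − F(h)`, the pattern functional `f(Q) = flankPay(Q) − λ·𝟙[#Q ≤ 2] + λ·C` has nonnegative
expectation at every vertex, hence at `h` (vertex principle `patE_vertex`, …Vertex): `E_h[flankPay] ≥ λ(1 − F(h) − C) ≥ 0`, and `G_avg − 1 = E_h[kernelPay] ≥
E_h[flankPay]` (…GameAvg): **`HairyCycle.witGavg_ge_one_of_cellCertT`**.  **`HairyCycle.witGavg_ge_one_of_cellGameT`** is the budget-window form used cell by
cell (thresholds `GameSpec.thr`, …GameThr; fast certificate `gameCertTF`, …GameFast): on `R` one takes `C = max(1 − η − η(Σ−4)/2, 0)`, and `t_B = min(⌈−λ·c_B·q^K·Lpay⌉, 0)`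
with `c_B = 1 − hi − hi(υB − 4)/2 ≤ 1 − η − η(Σ − 4)/2` (`η < hi`, `Σ ≤ υB`, `2 ≤ υB`).  (A per-budget CHOICE of `λ` would not be sound: the vertices of one box
carry different budgets.)  Elementary [this work]; no sorries; standard axioms.
-/

namespace Summit.CriticalPhenomena.PercolationContinuityZ3.Theorems.HairyCycle

open Finset

variable {K : ℕ}

/-- **THRESHOLD CERTIFICATE ⇒ `witGavg ≥ 1`.**  `P` well formed, `lamD ∣ Lpay`, `5 ≤ Amax`, `K ≤ Kcred`, `2 ≤ K`, a passed threshold certificate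
`gameCertT lamN lamD NB K Bt`, a cell assignment `c` (`c k + 1 < nL`) such that every vertex word `u` (`u k ∈ {c k, c k+1}`) has a listed budget `≤ NB` whose
threshold is `≥ −(lamN/lamD)·C·q^K·Lpay`; then every `h` in the box with `0 < h` and `C ≤ 1 − F(h)` has `1 ≤ witGavg K h 2`. [this work] -/
theorem witGavg_ge_one_of_cellCertT {P : GameSpec} (W : P.WF) {lamN lamD : ℕ} (hlam : lamD ∣ P.Lpay) (hlamD : 0 < lamD)
    (hA5 : 5 ≤ P.Amax) {NB : ℕ} (hKc : K ≤ P.Kcred) (hK : 2 ≤ K)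
    {Bt : List (ℕ × ℤ)} (hc : P.gameCertT lamN lamD NB K Bt = true) (c : ℕ → ℕ) (hcL : ∀ k, k < K → c k + 1 < P.nL)
    {C : ℝ}
    (hB : ∀ u : ℕ → ℕ, (∀ k, k < K → u k = c k ∨ u k = c k + 1) →
      ∃ t : ℤ, ((((List.range K).map u).map P.wOf).sum, t) ∈ Bt ∧ (((List.range K).map u).map P.wOf).sum ≤ NB ∧
        -(((lamN : ℝ) / lamD) * C * ((P.q : ℝ) ^ K * P.Lpay)) ≤ t)
    {h : ℕ → ℝ} (hh : ∀ k, k < K → P.gOf (c k) ≤ h k ∧ h k ≤ P.gOf (c k + 1)) (hpos : ∀ k, k < K → 0 < h k)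
    (hC : C ≤ 1 - hairV K h 2 (range K)) : 1 ≤ witGavg K h 2 := by
  set lam : ℝ := (lamN : ℝ) / lamD with hlamdef
  have hlam0 : 0 ≤ lam := by rw [hlamdef]; positivity
  -- the shifted functional
  set f : Finset ℕ → ℝ := fun Q => flankPay K Q - lam * (if Q.card ≤ 2 then (1 : ℝ) else 0) + lam * C with hf
  -- its expectation, expanded
  have hexp : ∀ g : ℕ → ℝ, ∑ Q ∈ (range K).powerset, hairW K g Q * f Q =
      ∑ Q ∈ (range K).powerset, hairW K g Q * flankPay K Q - lam * (1 - hairV K g 2 (range K)) + lam * C := by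
    intro g
    have e1 : ∀ Q, hairW K g Q * f Q =
        hairW K g Q * flankPay K Q - lam * (hairW K g Q * (if Q.card ≤ 2 then (1 : ℝ) else 0)) + lam * C * hairW K g Q := by
      intro Q; simp only [hf]; ring
    rw [Finset.sum_congr rfl (fun Q _ => e1 Q), Finset.sum_add_distrib, Finset.sum_sub_distrib, ← Finset.mul_sum, ← Finset.mul_sum,
      sum_hairW_card_le_two g, sum_hairW_eq_one, mul_one]
  have key : 0 ≤ ∑ Q ∈ (range K).powerset, hairW K h Q * f Q := by
    refine patE_vertex (K := K) f (a := fun k => P.gOf (c k)) (b := fun k => P.gOf (c k + 1)) (fun v hv => ?_) hh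
    -- the vertex `v` is the configuration of the word `u k = c k` or `c k + 1`
    classical
    let u : ℕ → ℕ := fun k => if v k = P.gOf (c k) then c k else c k + 1
    have hu : ∀ k, k < K → u k = c k ∨ u k = c k + 1 := fun k _ => by
      simp only [u]; split_ifs
      · exact Or.inl rfl
      · exact Or.inr rfl
    have huv : ∀ k, k < K → P.gOf (u k) = v k := fun k hk => by
      simp only [u]
      split_ifs with hvk
      · exact hvk.symm
      · rcases hv k hk with h1 | h2
        · exact absurd h1 hvk
        · exact h2.symm
    set word := (List.range K).map u with hword
    have hwlen : word.length = K := by simp [hword]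
    have hwmem : ∀ i ∈ word, i < P.nL := by
      intro i hi
      rw [hword, List.mem_map] at hi
      obtain ⟨k, hk, rfl⟩ := hi
      rcases hu k (List.mem_range.1 hk) with e | e <;> rw [e] <;> have := hcL k (List.mem_range.1 hk) <;> omega
    obtain ⟨t, hBt, hNB, ht⟩ := hB u hu
    have h0 := sum_hairW_flankPay_sub_ge_of_gameCertT W hlam hlamD hA5 hKc hc hK word hwmem hwlen hBt hNB
    have hcfg : ∀ k, k < K → (fun k => P.gOf (word.getD k 0)) k = v k := fun k hk => by
      simp only [hword]
      rw [List.getD_eq_getElem _ _ (by simpa using hk)]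
      simp [huv k hk]
    have hW : ∀ Q, hairW K (fun k => P.gOf (word.getD k 0)) Q = hairW K v Q := fun Q => hairW_congr hcfg Q
    have hV : hairV K (fun k => P.gOf (word.getD k 0)) 2 (range K) = hairV K v 2 (range K) := hairV_congr hcfg 2 (range K)
    simp only [hW, hV] at h0
    have hM : (0 : ℝ) < (P.q : ℝ) ^ K * P.Lpay := by
      have hL : (0 : ℝ) < P.Lpay := by exact_mod_cast W.Lpay_pos
      have hq : (0 : ℝ) < P.q := by exact_mod_cast W.q_pos
      positivity
    -- divide `−λ C M ≤ t ≤ M·(E_v[flankPay] − λ(1 − F(v)))` by `M`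
    have h1 : -(lam * C) ≤ ∑ Q ∈ (range K).powerset, hairW K v Q * flankPay K Q - lam * (1 - hairV K v 2 (range K)) := by
      by_contra hlt
      push Not at hlt
      have := mul_lt_mul_of_pos_left hlt hM
      linarith
    rw [hexp v]
    linarith
  rw [hexp h] at key
  -- `E_h[flankPay] ≥ λ(1 − F(h) − C) ≥ 0`, and `kernelPay ≥ flankPay`
  have hfl : 0 ≤ ∑ Q ∈ (range K).powerset, hairW K h Q * flankPay K Q := by nlinarith [mul_nonneg hlam0 (sub_nonneg.2 hC)]
  have hker : ∑ Q ∈ (range K).powerset, hairW K h Q * flankPay K Q ≤ ∑ Q ∈ (range K).powerset, hairW K h Q * kernelPay K Q :=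
    Finset.sum_le_sum fun Q _ => mul_le_mul_of_nonneg_left (flankPay_le_kernelPay Q)
      (hairW_nonneg (fun k hk => ⟨(hpos k hk).le, le_trans (hh k hk).2 (gOf_mem_unit W _).2⟩) Q)
  have := witGavg_sub_one_eq_sum_kernelPay hpos
  linarith

/-- `c(η, Σ) = 1 − η − η(Σ − 4)/2` is antitone in both arguments on `Σ ≥ 2`: `c(hi, T) ≤ c(η, Σ)` for `η ≤ hi`, `Σ ≤ T`, `2 ≤ T`, `0 ≤ η`. [this work] -/
theorem slackC_mono {η hi S T : ℝ} (hη : η ≤ hi) (hS : S ≤ T) (hT : 2 ≤ T) (hη0 : 0 ≤ η) :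
    1 - hi - hi * (T - 4) / 2 ≤ 1 - η - η * (S - 4) / 2 := by nlinarith

/-- **Generic Region II step with `R`-slack.**  As `witGavg_ge_one_of_cellGame` (…LayerTwoMid), for the threshold certificate
`gameCertTF lamN lamD (K·wmax) K (thrList lamN lamD hi υ K B_min (K·wmax − B_min + 1))` (fast evaluator): on a configuration `h` of the cell box with
least weight `h m < hi` (`m < K`), `S < Σh`, `(B_min − 1)υ ≤ S`, `2 ≤ B_min·υ`, and the `R`-slack `1 − η − η(Σ − 4)/2 ≤ 1 − F`, one has `1 ≤ witGavg K h 2`. [this work] -/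
theorem witGavg_ge_one_of_cellGameT {P : GameSpec} (W : P.WF) {lamN lamD : ℕ} (hlam : lamD ∣ P.Lpay) (hlamD : 0 < lamD)
    (hA5 : 5 ≤ P.Amax) (hKc : K ≤ P.Kcred) (hK : 2 ≤ K)
    {wmax Bmin : ℕ} {hi υ : ℚ}
    (hc : P.gameCertTF lamN lamD (K * wmax) K (P.thrList lamN lamD hi υ K Bmin (K * wmax - Bmin + 1)) = true)
    {S : ℝ} (hυ : (0 : ℝ) < υ) (hwt : ∀ j, j + 1 < P.nL → P.gOf (j + 1) ≤ P.wOf j * (υ : ℝ) ∧ P.gOf (j + 1) ≤ P.wOf (j + 1) * (υ : ℝ))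
    (hwmax : ∀ j, j < P.nL → P.wOf j ≤ wmax) (c : ℕ → ℕ) (hcL : ∀ k, k < K → c k + 1 < P.nL)
    {h : ℕ → ℝ} (hh : ∀ k, k < K → P.gOf (c k) ≤ h k ∧ h k ≤ P.gOf (c k + 1)) (hpos : ∀ k, k < K → 0 < h k)
    {m : ℕ} (hm : m < K) (hη : h m < hi)
    (hS : S < ∑ k ∈ range K, h k) (hB : ((Bmin : ℝ) - 1) * υ ≤ S) (hB2 : (2 : ℝ) ≤ Bmin * (υ : ℝ))
    (hR : 1 - h m - h m * (∑ k ∈ range K, h k - 4) / 2 ≤ 1 - hairV K h 2 (range K))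
    (hF1 : 0 ≤ 1 - hairV K h 2 (range K)) : 1 ≤ witGavg K h 2 := by
  rw [GameSpec.gameCertTF_eq] at hc
  set C : ℝ := max (1 - h m - h m * (∑ k ∈ range K, h k - 4) / 2) 0 with hCdef
  refine witGavg_ge_one_of_cellCertT W hlam hlamD hA5 hKc hK hc c hcL (C := C) (fun u hu => ?_) hh hpos (max_le hR hF1)
  obtain ⟨hlo, hhi⟩ := budget_window P hwt hwmax c hcL hh u hu
  set B := (((List.range K).map u).map P.wOf).sum with hBdef
  have hBmin : Bmin ≤ B := by
    have h1 : ((Bmin : ℝ) - 1) * υ < υ * (B : ℝ) := lt_of_le_of_lt hB (lt_of_lt_of_le hS hlo)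
    have h2 : (Bmin : ℝ) - 1 < B := by nlinarith
    have h3 : (Bmin : ℝ) < (B : ℝ) + 1 := by linarith
    exact_mod_cast Nat.lt_succ_iff.1 (by exact_mod_cast h3)
  refine ⟨P.thr lamN lamD hi υ K B, P.mem_thrList hBmin (by omega), hhi, le_trans ?_ (P.neg_le_thr lamN lamD hi υ K B)⟩
  -- `−λ·C·M ≤ −λ·max(c_B, 0)·M` since `max(c_B,0) ≤ C`
  have hcB : 1 - (hi : ℝ) - hi * ((υ : ℝ) * B - 4) / 2 ≤ 1 - h m - h m * (∑ k ∈ range K, h k - 4) / 2 := by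
    have hT : (2 : ℝ) ≤ (υ : ℝ) * B := by
      have : (Bmin : ℝ) * υ ≤ (B : ℝ) * υ := mul_le_mul_of_nonneg_right (by exact_mod_cast hBmin) hυ.le
      linarith
    have := slackC_mono hη.le (by linarith [hlo] : ∑ k ∈ range K, h k ≤ (υ : ℝ) * B) hT (hpos m hm).le
    linarith
  have hmax : max (1 - (hi : ℝ) - hi * ((υ : ℝ) * B - 4) / 2) 0 ≤ C := max_le_max hcB le_rfl
  have hlamM : (0 : ℝ) ≤ (lamN : ℝ) / lamD * ((P.q : ℝ) ^ K * P.Lpay) := by positivity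
  nlinarith [mul_le_mul_of_nonneg_left hmax hlamM]

end Summit.CriticalPhenomena.PercolationContinuityZ3.Theorems.HairyCycle
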